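import Summits.HodgeConjecture.HodgeConjecture.Theorems.Ring2ClassTargetsRowsSixSeven
import Summits.HodgeConjecture.HodgeConjecture.Theorems.Ring2WeilTypeTargets
import Literature.AlgebraicGeometry.HodgeTheory.WeilTypeAbelianVariety
import HarnessLib

/-!
# Ring 2 · kernel class targets ↔ the Weil-type column (bridge, by name)

HONEST FRAMING: research route conditional on HC_CM; not a corollary; Q11.4-sentence-2 already refuted in dim ≥ 3.

Cell `pub-hodge-ring2`, seat `pub-hodge-ring2-typer1` (cell lead). The two typer1 kernel layers — the CLASS-TARGET
frame `Ring2.ClassTargets` (`HCOnClass 𝒞`, rows `HCAtDim g`, `HCUpToDim g`; `Ring2ClassTargets*.lean`) and the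
WEIL-TYPE column `Ring2.WeilType` (`Ring2WeilTypeTargets.lean`: the targets `HC_WeilType`, `HC_WeilTypeAt[n, d]`,
`HC_AVDimLE[m]` as local notations over `IsWeilType A φ n d` / `WeilType A`) — do not import each other. This
file records, with no placeholders and no new definitions, how they fit:

* §B1 DICTIONARY. `HC_WeilType = HCOnClass WeilType` and `HC_AVDimLE[m] = HCUpToDim m` hold by `Iff.rfl`; the
  `(n, d)`-slice `HC_WeilTypeAt[n, d]` is the class target of `fun A ↦ ∃ φ, IsWeilType A φ n d`.
* §B2 ROWS ⟹ SLICES. Row `2n` gives every `(n, d)`-slice (`IsWeilType.dim_eq`); all even rows give `HC_WeilType`.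
* §B3 ROWS `6`, `7` VERSUS WEIL-TYPE SIXFOLDS AS VARIETIES. `Ring2ClassTargetsRowsSixSeven` reduces rows `≤ 7`
  EXACTLY to the Weil CLASSES of Weil-type sixfolds off a granted class `𝒞` (modulo the census X2 / X1 off `𝒞`
  and the floor `HCUpToDim 5`). Here the same rows are reduced to the full Hodge conjecture FOR the Weil-type
  sixfolds off `𝒞` — `∀ d A φ, IsWeilType A φ 3 d → ¬ 𝒞 A → HC(A)` — which sits between the two
  (row `6` ⟹ it ⟹ the Weil classes, the last step by Deligne's Prop. 4.4: a non-zero Hodge Weil class forces Weil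
  type, `isWeilType_of_weilClass_ne_zero`), hence is ALSO equivalent to rows `≤ 7` modulo the same inputs:
  `hcUpToDim_seven_iff_hcWeilTypeSixfoldsOff_of_censusOff`. With `𝒞 = CM ∪ 𝒦` and `HC_CM` (the binder
  `Theses.RankFourFaces.CMAbelianHodge`, item stmt-HodgeConjecture-3052, BY NAME) plus a granted cell `𝒦`:
  `hcUpToDim_seven_iff_hcWeilTypeSixfoldsOff_of_hcCM_of_hcOnClass`.
* §B4 audit (on-path).

References (bib keys): vanGeemen1994HodgeAV (Def. 4.9, Thm. 4.11), Deligne1982HodgeCycles (Prop. 4.4, §5),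
MoonenZarhin1999LowDim (Thm. 0.1, §5; arXiv:math/9901113), Markman2025SecantWeil = arXiv:2502.03415 (Thm. 1.5.1;
UNREFEREED), Milne1999 (§7 (H)), Weil1977HodgeRing, Deligne2000 (§1).
-/

set_option linter.dupNamespace false

noncomputable section

open CategoryTheory
open Literature.AlgebraicGeometry Literature.AlgebraicGeometry.Motives
open Literature.AlgebraicGeometry.HodgeTheory
open Literature.AlgebraicGeometry.Milne1999
open Literature.AlgebraicTopology.SingularHomology
open Literature.Barriers.HodgeConjecture

namespace Summit.HodgeConjecture.HodgeConjecture.Ring2.ClassTargets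

/-! ## §B1 Dictionary (definitional) -/

/-- `HC_WeilType` of `Ring2WeilTypeTargets` IS the class target of `WeilType`. [cite: vanGeemen1994HodgeAV, Def. 4.9] -/
theorem hcOnClass_weilType_iff :
    HCOnClass WeilType ↔ ∀ A : AbelianVariety ℂ, WeilType A → HodgeConjectureFor A.dim A.X :=
  Iff.rfl

/-- `HC_AVDimLE[m]` of `Ring2WeilTypeTargets` IS `HCUpToDim m`. [folklore] [cite: Deligne2000, §1] -/
theorem hcUpToDim_iff_dimLE (m : ℕ) :
    HCUpToDim m ↔ ∀ A : AbelianVariety ℂ, A.dim ≤ m → HodgeConjectureFor A.dim A.X :=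
  Iff.rfl

/-- The `(n, d)`-slice `HC_WeilTypeAt[n, d]` IS the class target of `fun A ↦ ∃ φ, IsWeilType A φ n d`.
[cite: vanGeemen1994HodgeAV, Def. 4.9] -/
theorem hcOnClass_isWeilType_iff (n d : ℕ) :
    HCOnClass (fun A ↦ ∃ φ : A ⟶ A, IsWeilType A φ n d) ↔
      ∀ (A : AbelianVariety ℂ) (φ : A ⟶ A), IsWeilType A φ n d → HodgeConjectureFor A.dim A.X :=
  ⟨fun h A φ hW ↦ h A ⟨φ, hW⟩, fun h A ⟨φ, hW⟩ ↦ h A φ hW⟩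

/-! ## §B2 Rows give slices -/

/-- **Row `2n` ⟹ the `(n, d)`-slice** (a Weil-type `(A, φ)` of signature `(n, n)` has `dim A = 2n`).
[cite: vanGeemen1994HodgeAV, Def. 4.9] -/
theorem hcWeilTypeAt_of_hcAtDim {n : ℕ} (h : HCAtDim (2 * n)) (d : ℕ) :
    ∀ (A : AbelianVariety ℂ) (φ : A ⟶ A), IsWeilType A φ n d → HodgeConjectureFor A.dim A.X :=
  fun A _ hW ↦ h A hW.dim_eq

/-- Row `6` ⟹ HC for every Weil-type sixfold (every `d`). [cite: vanGeemen1994HodgeAV, Def. 4.9] [cite: MoonenZarhin1999LowDim, §5] -/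
theorem hcWeilTypeSixfolds_of_hcAtDim_six (h : HCAtDim 6) (d : ℕ) :
    ∀ (A : AbelianVariety ℂ) (φ : A ⟶ A), IsWeilType A φ 3 d → HodgeConjectureFor A.dim A.X :=
  hcWeilTypeAt_of_hcAtDim (n := 3) h d

/-- All even rows ⟹ `HC_WeilType` (as the class target of `WeilType`). [cite: vanGeemen1994HodgeAV, Def. 4.9] -/
theorem hcOnClass_weilType_of_forall_hcAtDim_even (h : ∀ n : ℕ, HCAtDim (2 * n)) : HCOnClass WeilType :=
  fun A ⟨n, _, _, hW⟩ ↦ h n A hW.dim_eq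

/-- `HC_AV` ⟹ `HCOnClass WeilType` (= `Ring2.WeilType.hc_weilType_of_hc_av` read through §B1). [cite: Deligne2000, §1] -/
theorem hcOnClass_weilType_of_hodgeAbelianVarieties (h : Theses.PadicSemiregularLift.HodgeAbelianVarieties) :
    HCOnClass WeilType :=
  hcOnClass_of_hodgeAbelianVarieties _ h

/-! ## §B3 Rows `6`, `7` versus the Weil-type sixfolds off a granted class, as varieties -/

/-- **HC for the Weil-type sixfolds off `𝒞` gives the Weil CLASSES of Weil sixfolds off `𝒞`** (the cell `W₆` off
`𝒞` of `Ring2ClassTargetsRowsSixSeven`): a non-zero rational Hodge class in the Weil plane forces Weil type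
(Deligne–Milne Prop. 4.4 ⇒, `isWeilType_of_weilClass_ne_zero`), and `0` is algebraic.
[cite: Deligne1982HodgeCycles, §4 Prop. 4.4] [cite: Weil1977HodgeRing] -/
theorem weilSixfoldsOff_of_hcWeilTypeSixfoldsOff (𝒞 : AbelianVariety ℂ → Prop)
    (h : ∀ (d : ℕ) (A : AbelianVariety ℂ) (φ : A ⟶ A), IsWeilType A φ 3 d → ¬ 𝒞 A →
      HodgeConjectureFor A.dim A.X) :
    ∀ (d : ℕ), 0 < d → ∀ (B : AbelianVariety ℂ) (ψ : B ⟶ B), B.dim = 6 → ψ ≫ ψ = -(d • 𝟙 B) → ¬ 𝒞 B →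
      ∀ w : complexBetti B.X (2 * 3), IsRationalClass w → IsOfHodgeType B.dim B.X (2 * 3) 3 3 w →
        w ∈ weilClassesOf B ψ 3 d → w ∈ algebraicClasses B.X 3 := by
  intro d hd B ψ hB hψ hB𝒞 w hw h33 hW
  by_cases hw0 : w = 0
  · rw [hw0]
    exact Submodule.zero_mem _
  · rw [hB] at h33
    have hWT : IsWeilType B ψ 3 d := isWeilType_of_weilClass_ne_zero (by norm_num) hd hB hψ hW hw0 h33
    have hHC : HodgeConjectureFor B.dim B.X := h d B ψ hWT hB𝒞
    rw [hB] at hHC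
    exact hHC.2 3 w hw h33

/-- **Rows `≤ 7` ↔ HC FOR THE WEIL-TYPE SIXFOLDS OFF `𝒞`** — modulo a granted class `𝒞` (`HCOnClass 𝒞`), the
codimension census X2 / X1 demanded only OFF `𝒞`, and the floor `HCUpToDim 5`. `→` is unconditional (row `6`);
`←` = the Weil classes off `𝒞` (`weilSixfoldsOff_of_hcWeilTypeSixfoldsOff`) fed to
`hcUpToDim_seven_of_censusOff`. So in rows `6`, `7` "HC for Weil-type sixfolds", "their Weil classes are algebraic"
and "HC for all six- and sevenfolds" are the same statement modulo the census — the kernel form of the MAP's (c7).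
[cite: MoonenZarhin1999LowDim, §5; arXiv:math/9901113] [cite: Deligne1982HodgeCycles, §4 Prop. 4.4] [cite: Markman2025SecantWeil, Thm. 1.5.1] -/
theorem hcUpToDim_seven_iff_hcWeilTypeSixfoldsOff_of_censusOff {𝒞 : AbelianVariety ℂ → Prop} (h𝒞 : HCOnClass 𝒞)
    (h₃ : ∀ A : AbelianVariety ℂ, A.dim = 6 ∨ A.dim = 7 → ¬ 𝒞 A → ∀ c : complexBetti A.X (2 * 2),
      IsRationalClass c → IsOfHodgeType A.dim A.X (2 * 2) 2 2 c →
        c ∈ divisorClassesSpan A.X A.dim 2 ⊔ Submodule.span ℂ {w' : complexBetti A.X (2 * 2) |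
          ∃ (C : AbelianVariety ℂ) (g : A.X ⟶ C.X) (w : complexBetti C.X (2 * 2)), C.dim < A.dim ∧
            IsRationalClass w ∧ IsOfHodgeType C.dim C.X (2 * 2) 2 2 w ∧ w' = complexBetti.map g (2 * 2) w})
    (h₂ : ∀ A : AbelianVariety ℂ, A.dim = 6 ∨ A.dim = 7 → ¬ 𝒞 A → ∀ c : complexBetti A.X (2 * 3),
      IsRationalClass c → IsOfHodgeType A.dim A.X (2 * 3) 3 3 c →
        c ∈ divisorClassesSpan A.X A.dim 3 ⊔ Submodule.span ℂ {w' : complexBetti A.X (2 * 3) |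
            ∃ (a : complexBetti A.X (2 * 2)) (b : complexBetti A.X (2 * 1)),
              IsRationalClass a ∧ IsOfHodgeType A.dim A.X (2 * 2) 2 2 a ∧ IsRationalClass b ∧
              IsOfHodgeType A.dim A.X (2 * 1) 1 1 b ∧ w' = cupProduct (two_mul_add_two_mul 2 1) a b} ⊔
          Submodule.span ℂ {w' : complexBetti A.X (2 * 3) |
            ∃ (C : AbelianVariety ℂ) (g : A.X ⟶ C.X) (w : complexBetti C.X (2 * 3)), C.dim < A.dim ∧
              IsRationalClass w ∧ IsOfHodgeType C.dim C.X (2 * 3) 3 3 w ∧ w' = complexBetti.map g (2 * 3) w} ⊔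
          Submodule.span ℂ {w' : complexBetti A.X (2 * 3) |
            ∃ (B : AbelianVariety ℂ) (g : A.X ⟶ B.X) (d : ℕ) (ψ : B ⟶ B) (w : complexBetti B.X (2 * 3)),
              B.dim = 6 ∧ 0 < d ∧ ψ ≫ ψ = -(d • 𝟙 B) ∧ IsRationalClass w ∧
              IsOfHodgeType B.dim B.X (2 * 3) 3 3 w ∧ w ∈ weilClassesOf B ψ 3 d ∧
              w' = complexBetti.map g (2 * 3) w})
    (h₅ : HCUpToDim 5) :
    HCUpToDim 7 ↔
      ∀ (d : ℕ) (A : AbelianVariety ℂ) (φ : A ⟶ A), IsWeilType A φ 3 d → ¬ 𝒞 A →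
        HodgeConjectureFor A.dim A.X :=
  ⟨fun h d A φ hW _ ↦
      hcWeilTypeSixfolds_of_hcAtDim_six (hcAtDim_of_hcUpToDim (hcUpToDim_mono (by norm_num) h)) d A φ hW,
    fun h ↦ hcUpToDim_seven_of_censusOff h𝒞 h₃ h₂ (weilSixfoldsOff_of_hcWeilTypeSixfoldsOff 𝒞 h) h₅⟩

/-- **`HC_CM` + a granted cell `𝒦`: rows `≤ 7` ↔ HC for the Weil-type sixfolds outside `CM ∪ 𝒦`**, modulo the
census off `CM ∪ 𝒦` and the floor (`HC_CM` = the binder `Theses.RankFourFaces.CMAbelianHodge` by name, entering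
only through `hcOnClass_cmType_of_hcCM`; `𝒦` e.g. atlas-2's K3-partner cell). Not a corollary of `HC_CM`.
[cite: Milne1999, §7 (H)] [cite: Deligne1982HodgeCycles, §5] [cite: MoonenZarhin1999LowDim, §5; arXiv:math/9901113] -/
theorem hcUpToDim_seven_iff_hcWeilTypeSixfoldsOff_of_hcCM_of_hcOnClass (hCM : Theses.RankFourFaces.CMAbelianHodge)
    {𝒦 : AbelianVariety ℂ → Prop} (h𝒦 : HCOnClass 𝒦)
    (h₃ : ∀ A : AbelianVariety ℂ, A.dim = 6 ∨ A.dim = 7 → ¬ (IsOfCMType A ∨ 𝒦 A) →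
      ∀ c : complexBetti A.X (2 * 2), IsRationalClass c → IsOfHodgeType A.dim A.X (2 * 2) 2 2 c →
        c ∈ divisorClassesSpan A.X A.dim 2 ⊔ Submodule.span ℂ {w' : complexBetti A.X (2 * 2) |
          ∃ (C : AbelianVariety ℂ) (g : A.X ⟶ C.X) (w : complexBetti C.X (2 * 2)), C.dim < A.dim ∧
            IsRationalClass w ∧ IsOfHodgeType C.dim C.X (2 * 2) 2 2 w ∧ w' = complexBetti.map g (2 * 2) w})
    (h₂ : ∀ A : AbelianVariety ℂ, A.dim = 6 ∨ A.dim = 7 → ¬ (IsOfCMType A ∨ 𝒦 A) →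
      ∀ c : complexBetti A.X (2 * 3), IsRationalClass c → IsOfHodgeType A.dim A.X (2 * 3) 3 3 c →
        c ∈ divisorClassesSpan A.X A.dim 3 ⊔ Submodule.span ℂ {w' : complexBetti A.X (2 * 3) |
            ∃ (a : complexBetti A.X (2 * 2)) (b : complexBetti A.X (2 * 1)),
              IsRationalClass a ∧ IsOfHodgeType A.dim A.X (2 * 2) 2 2 a ∧ IsRationalClass b ∧
              IsOfHodgeType A.dim A.X (2 * 1) 1 1 b ∧ w' = cupProduct (two_mul_add_two_mul 2 1) a b} ⊔
          Submodule.span ℂ {w' : complexBetti A.X (2 * 3) |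
            ∃ (C : AbelianVariety ℂ) (g : A.X ⟶ C.X) (w : complexBetti C.X (2 * 3)), C.dim < A.dim ∧
              IsRationalClass w ∧ IsOfHodgeType C.dim C.X (2 * 3) 3 3 w ∧ w' = complexBetti.map g (2 * 3) w} ⊔
          Submodule.span ℂ {w' : complexBetti A.X (2 * 3) |
            ∃ (B : AbelianVariety ℂ) (g : A.X ⟶ B.X) (d : ℕ) (ψ : B ⟶ B) (w : complexBetti B.X (2 * 3)),
              B.dim = 6 ∧ 0 < d ∧ ψ ≫ ψ = -(d • 𝟙 B) ∧ IsRationalClass w ∧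
              IsOfHodgeType B.dim B.X (2 * 3) 3 3 w ∧ w ∈ weilClassesOf B ψ 3 d ∧
              w' = complexBetti.map g (2 * 3) w})
    (h₅ : HCUpToDim 5) :
    HCUpToDim 7 ↔
      ∀ (d : ℕ) (A : AbelianVariety ℂ) (φ : A ⟶ A), IsWeilType A φ 3 d → ¬ (IsOfCMType A ∨ 𝒦 A) →
        HodgeConjectureFor A.dim A.X :=
  hcUpToDim_seven_iff_hcWeilTypeSixfoldsOff_of_censusOff (𝒞 := fun A ↦ IsOfCMType A ∨ 𝒦 A)
    (hcOnClass_or_iff.mpr ⟨hcOnClass_cmType_of_hcCM hCM, h𝒦⟩) h₃ h₂ h₅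

/-! ## §B4 Audit: on-path -/

/-- Audit: `HCOnClass WeilType`, every slice, and HC for the Weil-type sixfolds off any class follow from
`HodgeConjecture`; the census hypotheses are never asserted. [cite: Deligne2000, §1] -/
theorem weilTypeBridge_of_hodgeConjecture (h : _root_.HodgeConjecture) (𝒞 : AbelianVariety ℂ → Prop) :
    HCOnClass WeilType ∧
      (∀ (n d : ℕ) (A : AbelianVariety ℂ) (φ : A ⟶ A), IsWeilType A φ n d → HodgeConjectureFor A.dim A.X) ∧
      ∀ (d : ℕ) (A : AbelianVariety ℂ) (φ : A ⟶ A), IsWeilType A φ 3 d → ¬ 𝒞 A →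
        HodgeConjectureFor A.dim A.X :=
  ⟨hcOnClass_of_hodgeConjecture _ h, fun n d ↦ hcWeilTypeAt_of_hcAtDim (n := n) (hcOnClass_of_hodgeConjecture _ h) d,
    fun d A φ hW _ ↦ hcWeilTypeSixfolds_of_hcAtDim_six (hcOnClass_of_hodgeConjecture _ h) d A φ hW⟩

end Summit.HodgeConjecture.HodgeConjecture.Ring2.ClassTargets

end
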